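import Literature.NumberTheory.GaloisRepresentations.TateModuleKummerCompletion
import HarnessLib

/-!
# Rigidity of the profinite completion of a commutative group: an endomorphism fixing `η(A)` is the
# identity

Topic `Literature/NumberTheory/GaloisRepresentations`, sequel of abc-iut-L4-t11's `PowCompletion` API
(`TateModuleKummerCompletion.lean`: the power components `proj n : Â → A/Aⁿ` of Mathlib's profinite completion
`Â = ProfiniteGrp.ProfiniteCompletion.completion (GrpCat.of A)` of a commutative group all of whose power
subgroups `Aⁿ` have finite index, `ext_of_proj`).  abc-iut cell, layer L4, abc-iut-L4-d3: the group-theoretic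
step of the UNIQUENESS of the natural isomorphism `H¹(G_k, μ_Ẑ(G_k)) ⥲ G_k^ab` of [AbsTopIII] Cor. 1.10 (i)(b)
from its values on the Kummer image of `kˣ` (`AbsTopIII/ReconstructionCor110ibNaturalFundUnique.lean`).

* bookkeeping: `mul_comm'` (`Â` is commutative), `isOpen_proj_fibre` (the fibres of
  `proj n` are open), `exists_eta_mul_of_proj` (every `x ∈ Â` is `η(a) · z` with `proj n z = 1` — DENSITY of
  `η(A)`, Mathlib `denseRange`), `mem_closure_of_proj_eq_one` / `exists_pow_eq_of_proj_eq_one` (the kernel of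
  `proj n` lies in the closure of `η(Aⁿ) ⊆ Âⁿ`, and `Âⁿ` — continuous image of the compact `Â` — is closed, so
  the kernel consists of `n`-th powers);
* `eq_one_of_forall_exists_pow_eq` — `Â` has NO non-trivial divisible element (read `d = yᵐ` in `A/Aᵐ`… more
  precisely in `A/Aⁿ` with `m = [A : Aⁿ] · n`-free form: the `A/Aⁿ`-component of an `[A:Aⁿ]`-th power is trivial);
* **`eq_of_forall_map_eta_eq`** — every (abstract, not necessarily continuous) group endomorphism `h` of `Â`
  with `h ∘ η = η` is the identity: `h(x)x⁻¹ = (h(y)y⁻¹)ⁿ` for every `n`, hence trivial.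

Elementary (Ribes–Zalesskii, *Profinite Groups*, Thm 2.7.1 / §3.2); theorems only, no named facts, no
`sorry`.  Nothing here bears on the disputed parts of IUT.
-/

noncomputable section

open CategoryTheory ProfiniteGrp ProfiniteGrp.ProfiniteCompletion Topology

universe u

namespace Literature.NumberTheory.GaloisRepresentations

namespace PowCompletion

variable {A : Type u} [CommGroup A]
  (hfin : ∀ n : ℕ+, ((powMonoidHom (n : ℕ) : A →* A).range).FiniteIndex)

include hfin in
/-- **`Â` is commutative** (componentwise in the commutative `A/Aⁿ`). [cite: RibesZalesskii2010, Thm 2.7.1] -/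
theorem mul_comm' (x y : completion (GrpCat.of A)) : x * y = y * x :=
  ext_of_proj hfin fun n => by rw [map_mul, map_mul, mul_comm]

/-- The fibres of `proj n : Â → A/Aⁿ` are open. [cite: RibesZalesskii2010, Thm 2.7.1] -/
theorem isOpen_proj_fibre (n : ℕ+) (c : A ⧸ (powMonoidHom (n : ℕ) : A →* A).range) :
    IsOpen ((proj hfin n) ⁻¹' {c}) := by
  have h1 : Continuous fun x : completion (GrpCat.of A) => x.1 (powLevel hfin n) :=
    (_root_.continuous_apply _).comp continuous_subtype_val
  have h2 : IsOpen ({c} : Set ((diagram (GrpCat.of A)).obj (powLevel hfin n))) := by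
    haveI : DiscreteTopology ((diagram (GrpCat.of A)).obj (powLevel hfin n)) := ⟨rfl⟩
    exact isOpen_discrete _
  exact h2.preimage h1

/-- **`x = η(a) · z` with `proj n z = 1`**, for every `x ∈ Â` and `n ≥ 1` (density of `η(A)`).
[cite: RibesZalesskii2010, Thm 2.7.1] -/
theorem exists_eta_mul_of_proj (n : ℕ+) (x : completion (GrpCat.of A)) :
    ∃ (a : A) (z : completion (GrpCat.of A)), proj hfin n z = 1 ∧ x = etaFn (GrpCat.of A) a * z := by
  obtain ⟨_, ⟨hy, a, rfl⟩⟩ :=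
    (denseRange (GrpCat.of A)).inter_open_nonempty _ (isOpen_proj_fibre hfin n (proj hfin n x)) ⟨x, rfl⟩
  refine ⟨a, (etaFn (GrpCat.of A) a)⁻¹ * x, ?_, by rw [mul_inv_cancel_left]⟩
  have hy' : proj hfin n (etaFn (GrpCat.of A) a) = proj hfin n x := hy
  rw [map_mul, map_inv, hy', inv_mul_cancel]

/-- The kernel of `proj n` lies in the closure of `η(Aⁿ)`. [cite: RibesZalesskii2010, Thm 2.7.1] -/
theorem mem_closure_of_proj_eq_one (n : ℕ+) {z : completion (GrpCat.of A)} (hz : proj hfin n z = 1) :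
    z ∈ closure (etaFn (GrpCat.of A) '' ((powMonoidHom (n : ℕ) : A →* A).range : Set A)) := by
  rw [mem_closure_iff]
  intro V hV hzV
  obtain ⟨_, ⟨⟨hyV, hy1⟩, a, rfl⟩⟩ := (denseRange (GrpCat.of A)).inter_open_nonempty _
    (hV.inter (isOpen_proj_fibre hfin n 1)) ⟨z, hzV, hz⟩
  refine ⟨etaFn (GrpCat.of A) a, hyV, a, ?_, rfl⟩
  have h1 : (QuotientGroup.mk a : A ⧸ (powMonoidHom (n : ℕ) : A →* A).range) = 1 := hy1
  exact (QuotientGroup.eq_one_iff a).mp h1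

/-- `Âⁿ` is closed (continuous image of a compact space in a Hausdorff space).
[cite: RibesZalesskii2010, Thm 2.7.1] -/
theorem isClosed_range_pow (n : ℕ) : IsClosed (Set.range fun y : completion (GrpCat.of A) => y ^ n) :=
  (isCompact_range (continuous_pow n)).isClosed

/-- **The kernel of `proj n` consists of `n`-th powers.** [cite: RibesZalesskii2010, Thm 2.7.1] -/
theorem exists_pow_eq_of_proj_eq_one (n : ℕ+) {z : completion (GrpCat.of A)} (hz : proj hfin n z = 1) :
    ∃ y : completion (GrpCat.of A), y ^ (n : ℕ) = z := by
  have hsub : etaFn (GrpCat.of A) '' ((powMonoidHom (n : ℕ) : A →* A).range : Set A) ⊆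
      Set.range fun y : completion (GrpCat.of A) => y ^ (n : ℕ) := by
    rintro _ ⟨a, ⟨b, rfl⟩, rfl⟩
    exact ⟨etaFn (GrpCat.of A) b, (map_pow (eta (GrpCat.of A)).hom b n).symm⟩
  exact (closure_minimal hsub (isClosed_range_pow (n : ℕ))) (mem_closure_of_proj_eq_one hfin n hz)

include hfin in
/-- **`Â` has no non-trivial divisible element**: an element that is an `n`-th power for every `n ≥ 1` is `1`
(its `A/Aⁿ`-component is the `[A : Aⁿ]`-th power of a class, hence trivial).
[cite: RibesZalesskii2010, Thm 2.7.1] -/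
theorem eq_one_of_forall_exists_pow_eq (d : completion (GrpCat.of A))
    (hd : ∀ n : ℕ+, ∃ y : completion (GrpCat.of A), y ^ (n : ℕ) = d) : d = 1 := by
  refine ext_of_proj hfin fun n => ?_
  haveI : ((powMonoidHom (n : ℕ) : A →* A).range).FiniteIndex := hfin n
  haveI : Finite (A ⧸ (powMonoidHom (n : ℕ) : A →* A).range) := Subgroup.finite_quotient_of_finiteIndex
  obtain ⟨y, hy⟩ := hd ⟨Nat.card (A ⧸ (powMonoidHom (n : ℕ) : A →* A).range), Nat.card_pos⟩
  rw [← hy, map_pow, map_one, PNat.mk_coe]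
  exact pow_card_eq_one'

include hfin in
/-- **Rigidity: an endomorphism of `Â` fixing `η(A)` pointwise is the identity** (no continuity assumed),
for a commutative group all of whose power subgroups have finite index: `h(x)x⁻¹` is an `n`-th power for every
`n ≥ 1`, hence `1`. [cite: RibesZalesskii2010, §3.2] -/
theorem eq_of_forall_map_eta_eq (h : completion (GrpCat.of A) →* completion (GrpCat.of A))
    (hη : ∀ a : A, h (etaFn (GrpCat.of A) a) = etaFn (GrpCat.of A) a) (x : completion (GrpCat.of A)) :
    h x = x := by
  rw [← mul_inv_eq_one]
  refine eq_one_of_forall_exists_pow_eq hfin _ fun n => ?_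
  obtain ⟨a, z, hz, rfl⟩ := exists_eta_mul_of_proj hfin n x
  obtain ⟨y, rfl⟩ := exists_pow_eq_of_proj_eq_one hfin n hz
  refine ⟨h y * y⁻¹, ?_⟩
  letI : CommGroup (completion (GrpCat.of A)) :=
    { (inferInstance : Group (completion (GrpCat.of A))) with mul_comm := mul_comm' hfin }
  rw [map_mul, hη, map_pow]
  symm
  calc etaFn (GrpCat.of A) a * h y ^ (n : ℕ) * (etaFn (GrpCat.of A) a * y ^ (n : ℕ))⁻¹
      = etaFn (GrpCat.of A) a * (h y ^ (n : ℕ) * (y ^ (n : ℕ))⁻¹) * (etaFn (GrpCat.of A) a)⁻¹ := by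
        rw [mul_inv_rev, ← mul_assoc, mul_assoc (etaFn (GrpCat.of A) a)]
    _ = h y ^ (n : ℕ) * (y ^ (n : ℕ))⁻¹ := mul_inv_cancel_comm _ _
    _ = (h y * y⁻¹) ^ (n : ℕ) := by rw [mul_pow, inv_pow]

end PowCompletion

end Literature.NumberTheory.GaloisRepresentations
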